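import Mathlib
import Summits.NavierStokesRegularity.NavierStokesRegularity.Theorems.RotatedEulerWindowDecayFluxRecurrence
import Summits.NavierStokesRegularity.NavierStokesRegularity.Theses.VortexLineClock
import HarnessLib

/-!
# `VortexLineClock.FluxCapacityRecurrence` — a.e. recurrence of the vortex lines of an Euler window
  profile (route `VortexLineClock`, item stmt-NavierStokesRegularity-11276, support; card P3)

**Statement.** For a window profile `(γ, U, Ω)` (the clauses of `TypeIIWindowCore`: `2/5 ≤ γ < 1/2`,
`U ∈ C²`, `Ω ∈ C¹`, `div U = 0`, `mΩ = curl U` with `m > 0`, `U, Ω` globally Lipschitz, the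
self-similar profile equations, CIV-matched decay `‖Ω y‖ ≤ C (1 + ‖y‖)^(-1/γ)`, `‖Ω 0‖ = 1`), almost
every point `y` with `Ω y ≠ 0` is forward-recurrent along its vortex line.

PROOF. This is the generic decay-recurrence theorem `RotatedEulerWindow.DecayFluxRecurrence`
(stmt-NavierStokesRegularity-19348, proved in `RotatedEulerWindowDecayFluxRecurrence.lean`: Liouville
+ slow escape ⇒ conservative time-one map ⇒ Poincaré–Halmos recurrence) at `β = γ`: of the window
clauses only `0 < γ < 1/2`, `U ∈ C²`, `Ω ∈ C¹`, `mΩ = curl U`, the Lipschitz bound on `Ω` and the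
decay of `Ω` are used (the profile equations, `div U = 0`, the decay of `U` and `‖Ω 0‖ = 1` are idle,
as the refuters recorded on the item).

HONEST FRAMING: a dynamical lemma about the vortex-line flow of HYPOTHETICAL self-similar Euler
profiles; nothing here bears on the regularity problem itself.
-/

noncomputable section

set_option linter.dupNamespace false

namespace Summit.NavierStokesRegularity.NavierStokesRegularity.Theorems

/-- **Item `VortexLineClock.FluxCapacityRecurrence` (stmt-NavierStokesRegularity-11276)**: the
vortex-line flow of an Euler window profile is a.e. recurrent — the case `β = γ` of
`rotatedEulerWindow_decayFluxRecurrence_proof`. -/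
theorem vortexLineClock_fluxCapacityRecurrence_proof :
    Theses.VortexLineClock.FluxCapacityRecurrence := by
  intro γ U Ω h
  obtain ⟨hγ1, hγ2, hU, hΩ, -, hm, ⟨L, -, hL⟩, -, ⟨C, hC⟩, -⟩ := h
  have hγ0 : 0 < γ := by linarith
  exact rotatedEulerWindow_decayFluxRecurrence_proof γ U Ω hγ0 hγ2 hU hΩ hm ⟨L, hL⟩
    ⟨C, fun y => (hC y).1⟩

end Summit.NavierStokesRegularity.NavierStokesRegularity.Theorems

end
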